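import Mathlib
import Summits.AtomisticToContinuum.HydrodynamicLimit.Theorems.InformationPercolationEngineKickFairRelEquilibriumMesoClosePairCountLongPathwise
import Summits.AtomisticToContinuum.HydrodynamicLimit.Theorems.InformationPercolationEngineKickFairRelEquilibriumMesoEnergyTailLG
import Summits.AtomisticToContinuum.HydrodynamicLimit.Theorems.InformationPercolationEngineKickFairRelEquilibriumMesoCutTransfer
import Summits.AtomisticToContinuum.HydrodynamicLimit.Theorems.InformationPercolationEngineKickFairRelEquilibriumMesoShortFlightRung0
import HarnessLib

/-!
# `KickFairRelEquilibriumMeso`, line `kinetic-window-cut` rev 5 — CPL, part 2: the registered stub `stub_closePairCountLong`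

Prover file (`--supports stmt-AtomisticToContinuum-15177`, lead c8) for the registered stub `stub_closePairCountLong : ClosePairCountLong rs` of the
skeleton `Cruxes/KickFairRelEquilibriumMeso/Lines/kinetic_window_cut.lean` (rev 5). The pathwise count of part 1 (`closePairCountLong_pathwise`,
p164215) is integrated against the LOCAL Gibbs law of continuous positive profiles: on the energy-typical set `{KE ≤ K(N+1)}` the
`(N+1)^{1/3}(ε/(N+1))²`-normalised count is at most `C₁ rs³ + C₂ (N+1)^{-1/6}` (`rs N = (N+1)^{-1/4}`, `ε = σ t_N`, `(N+1) t_N³ = 1`; packing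
term `∝ rs³/σ`, fast term `∝ K t_N²/rs²`), off it at most `C₃ (N+1)` while the set has `LG`-mass `≤ e^{-(N+1)}`
(`localGibbsLaw_kinEnergy_tail`, p162970); all three tend to `0`. So CPL holds for ALL continuous positive profiles (not only at equilibrium):
the close pairs of the long-flight window cut are a deterministic packing phenomenon.
-/

noncomputable section

open MeasureTheory Set Filter Topology
open scoped ENNReal Classical

namespace Summit.AtomisticToContinuum.HydrodynamicLimit.Theorems.KickFairRelEquilibriumMesoLine

open Literature.Analysis.FluidPDE Literature.MathematicalPhysics.KineticTheory

/-! ## Scaling identities and the budget -/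

/-- `(N+1)^{1/3} · t_N = 1`. [folklore] -/
theorem rpow_third_mul_tN (N : ℕ) : ((N : ℝ) + 1) ^ (1 / 3 : ℝ) * tN N = 1 := by
  have hN : (0 : ℝ) < (N : ℝ) + 1 := by positivity
  rw [tN, Real.rpow_neg hN.le, mul_inv_cancel₀ (by positivity)]

/-- `t_N² / rs² = (N+1)^{-1/6}`. [folklore] -/
theorem tN_sq_div_rs_sq (N : ℕ) : tN N ^ 2 / rs N ^ 2 = ((N : ℝ) + 1) ^ (-(1 / 6 : ℝ)) := by
  have hN : (0 : ℝ) < (N : ℝ) + 1 := by positivity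
  rw [tN, rs, ← Real.rpow_natCast, ← Real.rpow_natCast, ← Real.rpow_mul hN.le, ← Real.rpow_mul hN.le,
    ← Real.rpow_sub hN]
  norm_num

/-- **The budget tends to zero**: for all constants, eventually in `N`,
`C₁ rs³ + C₂ (N+1)^{-1/6} + C₃ (N+1) e^{-(N+1)} < δ`, `ε ≤ rs N` and `7 rs N + ε < 1/2` (`ε = σ t_N`). [folklore] -/
theorem cpl_budget_eventually (σ C₁ C₂ C₃ : ℝ) {δ : ℝ} (hδ : 0 < δ) :
    ∃ N₀ : ℕ, ∀ N : ℕ, N₀ ≤ N →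
      C₁ * rs N ^ 3 + C₂ * ((N : ℝ) + 1) ^ (-(1 / 6 : ℝ)) + C₃ * (((N : ℝ) + 1) * Real.exp (-((N : ℝ) + 1))) < δ ∧
      hsDiameter σ N ≤ rs N ∧ 7 * rs N + hsDiameter σ N < 1 / 2 := by
  have h1 : Tendsto (fun N : ℕ => ((N : ℝ) + 1)) atTop atTop :=
    tendsto_atTop_add_const_right _ 1 tendsto_natCast_atTop_atTop
  -- the three vanishing sequences
  have hA : Tendsto (fun N : ℕ => rs N ^ 3) atTop (𝓝 0) := by
    simpa using tendsto_rs.pow 3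
  have hB : Tendsto (fun N : ℕ => ((N : ℝ) + 1) ^ (-(1 / 6 : ℝ))) atTop (𝓝 0) :=
    (tendsto_rpow_neg_atTop (by norm_num : (0 : ℝ) < 1 / 6)).comp h1
  have hC : Tendsto (fun N : ℕ => ((N : ℝ) + 1) * Real.exp (-((N : ℝ) + 1))) atTop (𝓝 0) :=
    ((Real.tendsto_pow_mul_exp_neg_atTop_nhds_zero 1).comp h1).congr fun N => by
      simp only [Function.comp_apply, pow_one]
  have hsum : Tendsto (fun N : ℕ => C₁ * rs N ^ 3 + C₂ * ((N : ℝ) + 1) ^ (-(1 / 6 : ℝ)) +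
      C₃ * (((N : ℝ) + 1) * Real.exp (-((N : ℝ) + 1)))) atTop (𝓝 0) := by
    simpa using ((hA.const_mul C₁).add (hB.const_mul C₂)).add (hC.const_mul C₃)
  have hev1 : ∀ᶠ N : ℕ in atTop, C₁ * rs N ^ 3 + C₂ * ((N : ℝ) + 1) ^ (-(1 / 6 : ℝ)) +
      C₃ * (((N : ℝ) + 1) * Real.exp (-((N : ℝ) + 1))) < δ := (tendsto_order.1 hsum).2 δ hδ
  -- `ε/rs = σ (N+1)^{-1/12} → 0` and `rs → 0`
  have hD : Tendsto (fun N : ℕ => hsDiameter σ N) atTop (𝓝 0) := by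
    have h := (tendsto_rpow_neg_atTop (by norm_num : (0 : ℝ) < 1 / 3)).comp h1
    have h' : Tendsto (fun N : ℕ => σ * ((N : ℝ) + 1) ^ (-(1 / 3 : ℝ))) atTop (𝓝 (σ * 0)) := h.const_mul σ
    rw [mul_zero] at h'
    refine h'.congr fun N => ?_
    rw [hsDiameter_eq_mul_tN, tN]
  have hratio : Tendsto (fun N : ℕ => hsDiameter σ N / rs N) atTop (𝓝 0) := by
    have h := (tendsto_rpow_neg_atTop (by norm_num : (0 : ℝ) < 1 / 12)).comp h1
    have h' : Tendsto (fun N : ℕ => σ * ((N : ℝ) + 1) ^ (-(1 / 12 : ℝ))) atTop (𝓝 (σ * 0)) := h.const_mul σ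
    rw [mul_zero] at h'
    refine h'.congr fun N => ?_
    have hN : (0 : ℝ) < (N : ℝ) + 1 := by positivity
    rw [hsDiameter_eq_mul_tN, tN, rs, mul_div_assoc, ← Real.rpow_sub hN]
    norm_num
  have hev2 : ∀ᶠ N : ℕ in atTop, hsDiameter σ N / rs N < 1 := (tendsto_order.1 hratio).2 1 one_pos
  have hev3 : ∀ᶠ N : ℕ in atTop, rs N < 1 / 16 := (tendsto_order.1 tendsto_rs).2 _ (by norm_num)
  obtain ⟨N₀, hN₀⟩ := eventually_atTop.1 (hev1.and (hev2.and hev3))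
  refine ⟨N₀, fun N hN => ?_⟩
  obtain ⟨hb, hq, hr⟩ := hN₀ N hN
  have hrs := rs_pos N
  have hεr : hsDiameter σ N ≤ rs N := by
    rw [div_lt_one hrs] at hq
    exact hq.le
  exact ⟨hb, hεr, by linarith⟩

/-- The kinetic energy is a measurable function of the configuration. [folklore] -/
theorem measurable_kinEnergy' {N : ℕ} : Measurable (kinEnergy : Phase N → ℝ) := by
  unfold kinEnergy
  exact Finset.measurable_sum _ fun i _ => (measurable_pi_apply i).snd.norm.pow_const 2

/-! ## The algebra of the two bounds at fixed `N` -/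

/-- **The energy-typical bound**: with `ε ≤ rs N`, `P = (N+1)^{1/3}`, `c = ε/(N+1)`, `W' = ⌊τ/t_N⌋₊ + 1`, `G = ⌈2A⌉₊ + 1`,
`P c² W' (N+1)(A+1) G (((14 rs + ε)/ε)³ + K(N+1)/(rs A/t_N)²) ≤ (3375 (τ+1) G (A+1)/σ) rs³ + ((τ+1) σ² G (A+1) K/A²) (N+1)^{-1/6}`. [folklore] -/
theorem cpl_typical_bound_le {σ τ A K : ℝ} (hσ : 0 < σ) (hτ : 0 ≤ τ) (hA : 0 < A) (hK : 0 ≤ K) (N : ℕ)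
    (hεr : hsDiameter σ N ≤ rs N) :
    ((N : ℝ) + 1) ^ (1 / 3 : ℝ) * (hsDiameter σ N / ((N : ℝ) + 1)) ^ 2 *
        ((((⌊τ / tN N⌋₊ : ℝ) + 1) * (((N : ℝ) + 1) * (A + 1))) *
          (((⌈2 * A⌉₊ : ℝ) + 1) * (((14 * rs N + hsDiameter σ N) / hsDiameter σ N) ^ 3 +
            K * ((N : ℝ) + 1) / (rs N * A / tN N) ^ 2))) ≤
      3375 * (τ + 1) * ((⌈2 * A⌉₊ : ℝ) + 1) * (A + 1) / σ * rs N ^ 3 +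
        (τ + 1) * σ ^ 2 * ((⌈2 * A⌉₊ : ℝ) + 1) * (A + 1) * K / A ^ 2 * ((N : ℝ) + 1) ^ (-(1 / 6 : ℝ)) := by
  have hN : (0 : ℝ) < (N : ℝ) + 1 := by positivity
  have htN := tN_pos N
  have hrs := rs_pos N
  have hε0 : 0 < hsDiameter σ N := hsDiameter_pos hσ N
  have hε : hsDiameter σ N = σ * tN N := hsDiameter_eq_mul_tN σ N
  have hW : (⌊τ / tN N⌋₊ : ℝ) + 1 ≤ (τ + 1) * ((N : ℝ) + 1) ^ (1 / 3 : ℝ) := by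
    have := card_windows_le hτ N
    push_cast at this
    exact this
  -- the packing term: `((14 rs + ε)/ε)³ ≤ (15 rs/ε)³ = 3375 rs³ / (σ³ tN³)`
  have hX : ((14 * rs N + hsDiameter σ N) / hsDiameter σ N) ^ 3 ≤ 3375 * rs N ^ 3 / (σ ^ 3 * tN N ^ 3) := by
    have h15 : (14 * rs N + hsDiameter σ N) / hsDiameter σ N ≤ 15 * rs N / hsDiameter σ N :=
      div_le_div_of_nonneg_right (by linarith) hε0.le
    calc ((14 * rs N + hsDiameter σ N) / hsDiameter σ N) ^ 3 ≤ (15 * rs N / hsDiameter σ N) ^ 3 :=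
          pow_le_pow_left₀ (by positivity) h15 3
      _ = 3375 * rs N ^ 3 / (σ ^ 3 * tN N ^ 3) := by rw [hε]; ring
  have hfast : K * ((N : ℝ) + 1) / (rs N * A / tN N) ^ 2 = K / A ^ 2 * ((N : ℝ) + 1) * (tN N ^ 2 / rs N ^ 2) := by
    field_simp
  rw [hfast, tN_sq_div_rs_sq N]
  -- protect the two `rpow` atoms
  set Y : ℝ := ((N : ℝ) + 1) ^ (-(1 / 6 : ℝ)) with hY
  set P : ℝ := ((N : ℝ) + 1) ^ (1 / 3 : ℝ) with hP
  have hY0 : 0 ≤ Y := by positivity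
  have hP0 : 0 < P := by positivity
  have step1 : P * (hsDiameter σ N / ((N : ℝ) + 1)) ^ 2 *
        ((((⌊τ / tN N⌋₊ : ℝ) + 1) * (((N : ℝ) + 1) * (A + 1))) *
          (((⌈2 * A⌉₊ : ℝ) + 1) * (((14 * rs N + hsDiameter σ N) / hsDiameter σ N) ^ 3 +
            K / A ^ 2 * ((N : ℝ) + 1) * Y))) ≤
      P * (hsDiameter σ N / ((N : ℝ) + 1)) ^ 2 *
        (((τ + 1) * P * (((N : ℝ) + 1) * (A + 1))) *
          (((⌈2 * A⌉₊ : ℝ) + 1) * (3375 * rs N ^ 3 / (σ ^ 3 * tN N ^ 3) + K / A ^ 2 * ((N : ℝ) + 1) * Y))) := by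
    gcongr
  refine step1.trans (le_of_eq ?_)
  -- substitute `P = t⁻¹`, `N + 1 = (t³)⁻¹`, `ε = σ t`
  have hP' : P = (tN N)⁻¹ := eq_inv_of_mul_eq_one_left (rpow_third_mul_tN N)
  have hE' : ((N : ℝ) + 1) = (tN N ^ 3)⁻¹ := eq_inv_of_mul_eq_one_left (succ_mul_tN_pow_three N)
  rw [hε, hP', hE']
  field_simp

/-- **The crude bound off the typical set**: `P c² (W' (N+1)(A+1))² ≤ (τ+1)² (A+1)² σ² (N+1)`. [folklore] -/
theorem cpl_crude_bound_le {σ τ A : ℝ} (hτ : 0 ≤ τ) (hA : 0 < A) (N : ℕ) :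
    ((N : ℝ) + 1) ^ (1 / 3 : ℝ) * (hsDiameter σ N / ((N : ℝ) + 1)) ^ 2 *
        ((((⌊τ / tN N⌋₊ : ℝ) + 1) * (((N : ℝ) + 1) * (A + 1))) ^ 2) ≤
      (τ + 1) ^ 2 * (A + 1) ^ 2 * σ ^ 2 * ((N : ℝ) + 1) := by
  have hN : (0 : ℝ) < (N : ℝ) + 1 := by positivity
  have htN := tN_pos N
  have hε : hsDiameter σ N = σ * tN N := hsDiameter_eq_mul_tN σ N
  have hW : (⌊τ / tN N⌋₊ : ℝ) + 1 ≤ (τ + 1) * ((N : ℝ) + 1) ^ (1 / 3 : ℝ) := by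
    have := card_windows_le hτ N
    push_cast at this
    exact this
  have htN1 : tN N ≤ 1 := by
    rw [tN]
    exact Real.rpow_le_one_of_one_le_of_nonpos (by linarith [N.cast_nonneg (α := ℝ)]) (by norm_num)
  set P : ℝ := ((N : ℝ) + 1) ^ (1 / 3 : ℝ) with hP
  have hP0 : 0 < P := by positivity
  have hP' : P = (tN N)⁻¹ := eq_inv_of_mul_eq_one_left (rpow_third_mul_tN N)
  have hE' : ((N : ℝ) + 1) = (tN N ^ 3)⁻¹ := eq_inv_of_mul_eq_one_left (succ_mul_tN_pow_three N)
  calc P * (hsDiameter σ N / ((N : ℝ) + 1)) ^ 2 * ((((⌊τ / tN N⌋₊ : ℝ) + 1) * (((N : ℝ) + 1) * (A + 1))) ^ 2)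
      ≤ P * (hsDiameter σ N / ((N : ℝ) + 1)) ^ 2 * (((τ + 1) * P * (((N : ℝ) + 1) * (A + 1))) ^ 2) := by gcongr
    _ = (τ + 1) ^ 2 * (A + 1) ^ 2 * σ ^ 2 * (tN N)⁻¹ := by
        rw [hε, hP', hE']
        field_simp
    _ ≤ (τ + 1) ^ 2 * (A + 1) ^ 2 * σ ^ 2 * ((N : ℝ) + 1) := by
        rw [hE']
        gcongr
        -- `t³ ≤ t` for `0 < t ≤ 1`
        calc tN N ^ 3 ≤ tN N ^ 1 := pow_le_pow_of_le_one htN.le htN1 (by norm_num)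
          _ = tN N := pow_one _

/-! ## The registered stub -/

/-- **STUB CPL `stub_closePairCountLong` — THE CLOSE SAME-WINDOW PAIRS OF LONG-FLIGHT KICKS ARE FEW IN `LG`-MEAN** (registered stub of the line
`kinetic-window-cut`, rev 5): `ClosePairCountLong rs` for ALL continuous positive profiles. Given the profiles take `K, N₁` from the `LG` energy
tail; `σ₀ := 1/2`; given `σ, Φ, τ, A, δ` take `N₂` from the budget (`cpl_budget_eventually` with the constants of `cpl_typical_bound_le` /
`cpl_crude_bound_le`), `N₀ := max N₁ N₂`. At fixed `N ≥ N₀`, `LG`-a.e. (good set, genuine enumeration) the normalised count is `≤ B₁` on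
`{KE ≤ K⁺(N+1)}` and `≤ B₂` off it (`closePairCountLong_pathwise`), so its mean is `≤ B₁ + B₂ e^{-(N+1)} < δ`. [folklore] -/
theorem stub_closePairCountLong : ClosePairCountLong rs := by
  intro a₀ θ₀ u₀ ha hθ hu ha0 hθ0
  obtain ⟨K, N₁, hK⟩ := localGibbsLaw_kinEnergy_tail a₀ θ₀ u₀ ha hθ hu ha0 hθ0
  refine ⟨1 / 2, by norm_num, ?_⟩
  intro σ hσ hσlt Φ τ hτ A hA δ hδ
  have hσ2 : σ ≤ 1 / 2 := hσlt.le
  set Kc : ℝ := max K 0 with hKc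
  have hKc0 : 0 ≤ Kc := le_max_right _ _
  -- constants of the budget
  obtain ⟨N₂, hN₂⟩ := cpl_budget_eventually σ (3375 * (τ + 1) * ((⌈2 * A⌉₊ : ℝ) + 1) * (A + 1) / σ)
    ((τ + 1) * σ ^ 2 * ((⌈2 * A⌉₊ : ℝ) + 1) * (A + 1) * Kc / A ^ 2) ((τ + 1) ^ 2 * (A + 1) ^ 2 * σ ^ 2) hδ
  refine ⟨max N₁ N₂, fun N hN => ?_⟩
  have hN1 : N₁ ≤ N := (le_max_left _ _).trans hN
  obtain ⟨hbud, hεr, hroom⟩ := hN₂ N ((le_max_right _ _).trans hN)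
  have hN0 : (0 : ℝ) < (N : ℝ) + 1 := by positivity
  have htN := tN_pos N
  have hrs := rs_pos N
  have hV : 0 < rs N * A / tN N := by positivity
  set LG := localGibbsLaw σ a₀ u₀ θ₀ N (Φ N) with hLG
  haveI : IsProbabilityMeasure LG := isProbabilityMeasure_localGibbsLaw ha hθ hu ha0 hθ0 hσ2 N (Φ N)
  set Pn : ℝ := ((N : ℝ) + 1) ^ (1 / 3 : ℝ) * (hsDiameter σ N / ((N : ℝ) + 1)) ^ 2 with hPn
  have hPn0 : 0 ≤ Pn := by positivity
  -- the long/long/close pair count, as a function of the datum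
  set S : Phase N → ℝ := fun z => ∑ i : Fin (N + 1), ∑ n ∈ Finset.range (cnt (Φ N) τ z i),
      ∑ i' : Fin (N + 1), ∑ n' ∈ Finset.range (cnt (Φ N) τ z i'),
        (if IsLong A (tN N) (past (Φ N) (rs N) z i n) ∧ IsLong A (tN N) (past (Φ N) (rs N) z i' n') ∧
            PairCloseL (rs N) A (tN N) (past (Φ N) (rs N) z i n) (past (Φ N) (rs N) z i' n') i i'
          then (1 : ℝ) else 0) with hS
  -- the two deterministic bounds
  set W₁ : ℝ := ((⌊τ / tN N⌋₊ : ℝ) + 1) * (((N : ℝ) + 1) * (A + 1)) with hW₁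
  have hW₁0 : 0 ≤ W₁ := by positivity
  set X : ℝ := ((14 * rs N + hsDiameter σ N) / hsDiameter σ N) ^ 3 with hX
  set B₁ : ℝ := Pn * (W₁ * (((⌈2 * A⌉₊ : ℝ) + 1) * (X + Kc * ((N : ℝ) + 1) / (rs N * A / tN N) ^ 2))) with hB₁
  set B₂ : ℝ := Pn * W₁ ^ 2 with hB₂
  have hB₁le : B₁ ≤ 3375 * (τ + 1) * ((⌈2 * A⌉₊ : ℝ) + 1) * (A + 1) / σ * rs N ^ 3 +
      (τ + 1) * σ ^ 2 * ((⌈2 * A⌉₊ : ℝ) + 1) * (A + 1) * Kc / A ^ 2 * ((N : ℝ) + 1) ^ (-(1 / 6 : ℝ)) :=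
    cpl_typical_bound_le hσ hτ.le hA hKc0 N hεr
  have hB₂le : B₂ ≤ (τ + 1) ^ 2 * (A + 1) ^ 2 * σ ^ 2 * ((N : ℝ) + 1) := cpl_crude_bound_le hτ.le hA N
  have hε0 := hsDiameter_pos hσ N
  have hX0 : 0 ≤ X := pow_nonneg (div_nonneg (by linarith) hε0.le) 3
  have hG0 : (0 : ℝ) ≤ (⌈2 * A⌉₊ : ℝ) + 1 := by positivity
  have hB₁0 : 0 ≤ B₁ :=
    mul_nonneg hPn0 (mul_nonneg hW₁0 (mul_nonneg hG0 (add_nonneg hX0 (div_nonneg (mul_nonneg hKc0 hN0.le) (sq_nonneg _)))))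
  have hB₂0 : 0 ≤ B₂ := mul_nonneg hPn0 (sq_nonneg _)
  -- the energy-atypical set
  set Ebad : Set (Phase N) := {z | Kc * ((N : ℝ) + 1) < kinEnergy z} with hEbad
  have hEbad_meas : MeasurableSet Ebad := measurableSet_lt measurable_const measurable_kinEnergy'
  have hEbad_le : LG Ebad ≤ ENNReal.ofReal (Real.exp (-((N : ℝ) + 1))) := by
    refine (measure_mono ?_).trans (hK N hN1 σ hσ hσlt (Φ N))
    intro z hz
    simp only [hEbad, Set.mem_setOf_eq] at hz ⊢
    exact lt_of_le_of_lt (mul_le_mul_of_nonneg_right (le_max_left _ _) hN0.le) hz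
  -- the pointwise bound, a.e. (good set, genuine enumeration)
  have hgood : ∀ᵐ z ∂LG, z ∈ (Φ N).good := mem_ae_iff.2 (localGibbsLaw_compl_good_eq_zero (Φ N))
  have hgen := ae_forall_lt_cnt_iff_pastTime (a₀ := a₀) (θ₀ := θ₀) (u₀ := u₀) hσ2 (Φ N) τ (rs N)
  have hpt : ∀ᵐ z ∂LG, ENNReal.ofReal (Pn * S z) ≤ ENNReal.ofReal B₁ + Ebad.indicator (fun _ => ENNReal.ofReal B₂) z := by
    filter_upwards [hgood, hgen] with z hz hzg
    have hgen' : ∀ i : Fin (N + 1), ∀ n : ℕ, n < cnt (Φ N) τ z i → (Φ N).nthCollisionTimeOf i n z ∈ Set.Ioc 0 τ := by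
      intro i n hn
      have h := (hzg i n).1 hn
      have hpast : (past (Φ N) (rs N) z i n).2.2.2 = (Φ N).nthCollisionTimeOf i n z := by simp [past, hz]
      rwa [hpast] at h
    have hpath := closePairCountLong_pathwise σ N (Φ N) τ (rs N) A hσ hrs hA hroom z hz hgen'
    by_cases hE : z ∈ Ebad
    · rw [Set.indicator_of_mem hE]
      calc ENNReal.ofReal (Pn * S z) ≤ ENNReal.ofReal B₂ :=
            ENNReal.ofReal_le_ofReal (mul_le_mul_of_nonneg_left (hpath.trans (min_le_right _ _)) hPn0)
        _ ≤ ENNReal.ofReal B₁ + ENNReal.ofReal B₂ := le_add_self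
    · rw [Set.indicator_of_notMem hE, add_zero]
      refine ENNReal.ofReal_le_ofReal ?_
      have hKE : kinEnergy z ≤ Kc * ((N : ℝ) + 1) := by
        simp only [hEbad, Set.mem_setOf_eq, not_lt] at hE
        exact hE
      have hdiv : kinEnergy z / (rs N * A / tN N) ^ 2 ≤ Kc * ((N : ℝ) + 1) / (rs N * A / tN N) ^ 2 :=
        div_le_div_of_nonneg_right hKE (by positivity)
      calc Pn * S z ≤ Pn * (W₁ * (((⌈2 * A⌉₊ : ℝ) + 1) * (X + kinEnergy z / (rs N * A / tN N) ^ 2))) :=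
            mul_le_mul_of_nonneg_left (hpath.trans (min_le_left _ _)) hPn0
        _ ≤ B₁ := by
            simp only [hB₁]
            gcongr
  -- integrate
  calc ∫⁻ z, ENNReal.ofReal (Pn * S z) ∂LG
      ≤ ∫⁻ z, ENNReal.ofReal B₁ + Ebad.indicator (fun _ => ENNReal.ofReal B₂) z ∂LG := lintegral_mono_ae hpt
    _ = ENNReal.ofReal B₁ * LG Set.univ + ENNReal.ofReal B₂ * LG Ebad := by
        rw [lintegral_add_left measurable_const, lintegral_const, lintegral_indicator_const hEbad_meas]
    _ ≤ ENNReal.ofReal B₁ * 1 + ENNReal.ofReal B₂ * ENNReal.ofReal (Real.exp (-((N : ℝ) + 1))) := by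
        gcongr
        exact prob_le_one
    _ = ENNReal.ofReal (B₁ + B₂ * Real.exp (-((N : ℝ) + 1))) := by
        rw [mul_one, ← ENNReal.ofReal_mul hB₂0, ← ENNReal.ofReal_add hB₁0 (by positivity)]
    _ ≤ ENNReal.ofReal δ := by
        refine ENNReal.ofReal_le_ofReal ?_
        have hexp : 0 ≤ Real.exp (-((N : ℝ) + 1)) := (Real.exp_pos _).le
        have h2 : B₂ * Real.exp (-((N : ℝ) + 1)) ≤
            (τ + 1) ^ 2 * (A + 1) ^ 2 * σ ^ 2 * (((N : ℝ) + 1) * Real.exp (-((N : ℝ) + 1))) := by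
          rw [← mul_assoc]
          exact mul_le_mul_of_nonneg_right hB₂le hexp
        linarith

end Summit.AtomisticToContinuum.HydrodynamicLimit.Theorems.KickFairRelEquilibriumMesoLine

end
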